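import Mathlib
import HarnessLib
import Summits.HubbardSuperconductivity.HubbardSuperconductivity.Theorems.KLProgrammeKLRegimeTwoVolumeScaleZeroData
import Summits.HubbardSuperconductivity.HubbardSuperconductivity.Theorems.KLProgrammeKLRegimeTwoVolumeDataKit
import Summits.HubbardSuperconductivity.HubbardSuperconductivity.Theorems.KLProgrammeKLRegimeTwoVolumeRateKit
import Summits.HubbardSuperconductivity.HubbardSuperconductivity.Theorems.KLProgrammeKLRegimeEngineScaleZeroAlphaWX5
import Summits.HubbardSuperconductivity.HubbardSuperconductivity.Theorems.KLProgrammeKLRegimeEngineV8DefsU9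

/-!
# The scale-`0` spatial leg of stub (M) `stub_twoLeg_scale0` (stmt-HubbardSuperconductivity-20437): ONE-VOLUME DATA IN THE REGISTERED CURRENCY
# and the smallness numerals under the frozen door `U ≤ klEngU₀9 P R c` (cell gate-hubbard-kl, seat p1b g9, (M) owner — FILE F, part 1)

The β′ two-volume door `abs_klLocalPart_flowFrame_zero_sub_le_of_gridData(_maj)` (k3c5-p2, …TwoVolumeScaleZeroLeg) takes, for the
scale-`0` grid covariance `G_L = S_Lᵀ·C⁰_{>e₀}·S_L` on the grid `N = 2(2M)`, one-volume data: row sums, first moments, far tails, sup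
entries, Gram property, grid partition function, kernel profiles, and two smallness conditions.  This file supplies them at the
thresholds of the REGISTERED stub (M) (`klEngL₃ β U ≤ L`, `klEngM₃ β U L ≤ M`, `klBetaMin ≤ β`, `|U| ≤ 1`, bare frame admissible at depth `0`):

* §1 numerals: `√(2(7+6047)) ≤ 111`, `(e²(√(2(7+6047)) + 2^15))⁴ ≤ 2^72`, the two geometric ratios at
  `ρ₀ = 2^15`, `ρf = 1`, `ρ₂ = 2^10` are `≤ 1/2`;
* §2 the two consequences of the frozen door `0 < U ≤ klEngU₀9 P R c`: `klE3A1 R · U ≤ 2^-80` (via `klE3U₀all`, `klE3Acum = 2^40·klE3A1`,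
  `64·e⁹·2(7+1606732) ≥ 2^40`) and `U ≤ 2^-128` (via `klEngU₀4`);
* §3 one-volume data with the constant `a := klE3A1 R` (p3's `rowSum/colSum_scaleZero_gridLabelWt_le_X5` at frame depth `0` majorised by
  `bareAlphaOne_le_klE3A1`): `gridLabelWt`-weighted, `(1+tnorm)`-weighted, plain, `tnorm`-weighted and reduced-`tnorm`-weighted rows `≤ (N/β)·a`,
  far row tails `≤ (N/β)·a/(R+1)` (…TwoVolumeDataKit);
* §4 `scaleZero_gridData` (FILE D) at `ρ₀ = 2^15` with its smallness DISCHARGED under `klE3A1 R·|U| ≤ 2^-80`: Gram `√(2(7+6047))`, unit grid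
  partition function, and the profile `≤ (2^15)⁻¹^(2m′)·(6·2^72·|U|·|β|/N)` in every even degree (`normV_bareGridVertex`).

Proofs only; no definitions; nothing about superconductivity is asserted.  References: BGM 2006 §2–3 [cite: BenfattoGiulianiMastropietro2006].
-/

noncomputable section

namespace Summit.HubbardSuperconductivity.HubbardSuperconductivity.Theorems.TwoVolumeDefect

set_option linter.dupNamespace false -- summit = problem name (single-conjunct summit), D-0017

open Finset Literature.MathematicalPhysics.QuantumLattice GrassmannAlgebra Literature.Probability.LatticeModels
  Literature.Probability.LatticeModels.BattleFederbush
open Summit.HubbardSuperconductivity.HubbardSuperconductivity.Theorems.EngineV8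
open Summit.HubbardSuperconductivity.HubbardSuperconductivity.Theorems.KLRegimeSplit
open scoped Nat

/-! ## §1 Numerals -/

/-- `√(2(7+6047)) ≤ 111` (`111² = 12321 ≥ 12108`). -/
theorem sqrt_gramSharp_le : Real.sqrt (2 * (7 + 6047)) ≤ 111 := by
  rw [Real.sqrt_le_left (by norm_num)]; norm_num

/-- `0 < √(2(7+6047))`. -/
theorem sqrt_gramSharp_pos : 0 < Real.sqrt (2 * (7 + 6047)) := Real.sqrt_pos.2 (by norm_num)

/-- `√(2(7+6047))² = 2(7+6047)`. -/
theorem sqrt_gramSharp_sq : Real.sqrt (2 * (7 + 6047)) ^ 2 = 2 * (7 + 6047) := Real.sq_sqrt (by norm_num)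

/-- **The bare vertex weight at `ρ₀ = 2^15`**: `(e²(√(2(7+6047)) + 2^15))⁴ ≤ 2^72`. -/
theorem vertexWeight_pow_four_le_two_pow : (Real.exp 2 * (Real.sqrt (2 * (7 + 6047)) + 2 ^ 15)) ^ 4 ≤ (2 : ℝ) ^ 72 := by
  have h1 : Real.exp 2 ≤ 739 / 100 := by
    have h := Real.exp_one_lt_d9
    have h0 := Real.exp_pos 1
    have h2 : Real.exp 2 = Real.exp 1 ^ 2 := by rw [Real.exp_one_pow]; norm_num
    rw [h2]; nlinarith
  have h2 := sqrt_gramSharp_le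
  have h0 : 0 ≤ Real.exp 2 * (Real.sqrt (2 * (7 + 6047)) + 2 ^ 15) := by positivity
  have h3 : Real.exp 2 * (Real.sqrt (2 * (7 + 6047)) + 2 ^ 15) ≤ 739 / 100 * (111 + 2 ^ 15) := by
    gcongr
  calc (Real.exp 2 * (Real.sqrt (2 * (7 + 6047)) + 2 ^ 15)) ^ 4 ≤ (739 / 100 * (111 + 2 ^ 15)) ^ 4 := by gcongr
    _ ≤ (2 : ℝ) ^ 72 := by norm_num

/-- **The geometric ratio of the first weighted step** (`κ + κ′ = 2√(2(7+6047))`, `ρf = 1`, `ρ₀ = 2^15`): `≤ 1/2`. -/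
theorem ratio_f_le_half :
    Real.exp 2 * (Real.sqrt (2 * (7 + 6047)) + Real.sqrt (2 * (7 + 6047)) + 1) * ((2 : ℝ) ^ 15)⁻¹ ≤ 1 / 2 := by
  have h1 : Real.exp 2 ≤ 739 / 100 := by
    have h := Real.exp_one_lt_d9
    have h0 := Real.exp_pos 1
    have h2 : Real.exp 2 = Real.exp 1 ^ 2 := by rw [Real.exp_one_pow]; norm_num
    rw [h2]; nlinarith
  have h2 := sqrt_gramSharp_le
  have h0 : 0 ≤ Real.exp 2 := (Real.exp_pos 2).le
  have h3 : Real.exp 2 * (Real.sqrt (2 * (7 + 6047)) + Real.sqrt (2 * (7 + 6047)) + 1) ≤ 739 / 100 * (111 + 111 + 1) := by gcongr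
  rw [← div_eq_mul_inv, div_le_iff₀ (by positivity)]
  linarith

/-- **The geometric ratio of the second weighted step** (`3(κ + κ′) = 6√(2(7+6047))`, `ρ₂ = 2^10`, `ρ₀ = 2^15`): `≤ 1/2`. -/
theorem ratio_two_le_half :
    Real.exp 2 * (Real.sqrt (2 * (7 + 6047)) + Real.sqrt (2 * (7 + 6047)) +
        (Real.sqrt (2 * (7 + 6047)) + Real.sqrt (2 * (7 + 6047)) + (Real.sqrt (2 * (7 + 6047)) + Real.sqrt (2 * (7 + 6047)))) +
        (2 : ℝ) ^ 10) * ((2 : ℝ) ^ 15)⁻¹ ≤ 1 / 2 := by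
  have h1 : Real.exp 2 ≤ 739 / 100 := by
    have h := Real.exp_one_lt_d9
    have h0 := Real.exp_pos 1
    have h2 : Real.exp 2 = Real.exp 1 ^ 2 := by rw [Real.exp_one_pow]; norm_num
    rw [h2]; nlinarith
  have h2 := sqrt_gramSharp_le
  have h0 : 0 ≤ Real.exp 2 := (Real.exp_pos 2).le
  have h3 : Real.exp 2 * (Real.sqrt (2 * (7 + 6047)) + Real.sqrt (2 * (7 + 6047)) +
        (Real.sqrt (2 * (7 + 6047)) + Real.sqrt (2 * (7 + 6047)) + (Real.sqrt (2 * (7 + 6047)) + Real.sqrt (2 * (7 + 6047)))) +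
        (2 : ℝ) ^ 10) ≤ 739 / 100 * (111 + 111 + (111 + 111 + (111 + 111)) + 2 ^ 10) := by gcongr
  rw [← div_eq_mul_inv, div_le_iff₀ (by positivity)]
  linarith

/-- `2^40 ≤ 64·e⁹·2(7+1606732)` (`e ≥ 2.7`). -/
theorem two_pow_40_le_door_denominator : (2 : ℝ) ^ 40 ≤ 64 * Real.exp 1 ^ 9 * Real.sqrt (2 * (7 + 1606732)) ^ 2 := by
  rw [Real.sq_sqrt (by norm_num)]
  have he : (2.7 : ℝ) ≤ Real.exp 1 := by have := Real.exp_one_gt_d9; linarith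
  have h9 : (2.7 : ℝ) ^ 9 ≤ Real.exp 1 ^ 9 := pow_le_pow_left₀ (by norm_num) he 9
  nlinarith

/-! ## §2 The two consequences of the frozen door `U ≤ klEngU₀9 P R c` -/

/-- **Route (a)**: `0 < U ≤ klEngU₀9 P R c ⟹ klE3A1 R · U ≤ 2^-80` (through `klE3U₀all R`'s first branch and `klE3Acum = 2^40·klE3A1`). -/
theorem klE3A1_mul_le_of_le_klEngU₀9 (P : SplitConsts) {R : RenConsts} {c U : ℝ} (hUle : U ≤ klEngU₀9 P R c) :
    klE3A1 R * U ≤ 1 / (2 : ℝ) ^ 80 := by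
  have hA := klE3A1_pos R
  have hall : U ≤ 1 / (64 * Real.exp 1 ^ 9 * Real.sqrt (2 * (7 + 1606732)) ^ 2 * klE3Acum R) :=
    (hUle.trans (klEngU₀9_le_klE3U₀all P R c)).trans (min_le_left _ _)
  have hden := two_pow_40_le_door_denominator
  have hD : 0 < 64 * Real.exp 1 ^ 9 * Real.sqrt (2 * (7 + 1606732)) ^ 2 := lt_of_lt_of_le (by positivity) hden
  rw [klE3Acum] at hall
  have h1 : klE3A1 R * U ≤ klE3A1 R * (1 / (64 * Real.exp 1 ^ 9 * Real.sqrt (2 * (7 + 1606732)) ^ 2 * ((2 : ℝ) ^ 40 * klE3A1 R))) :=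
    mul_le_mul_of_nonneg_left hall hA.le
  refine h1.trans ?_
  rw [mul_one_div, div_le_div_iff₀ (by positivity) (by positivity), one_mul]
  calc klE3A1 R * (2 : ℝ) ^ 80 = (2 : ℝ) ^ 40 * ((2 : ℝ) ^ 40 * klE3A1 R) := by ring
    _ ≤ 64 * Real.exp 1 ^ 9 * Real.sqrt (2 * (7 + 1606732)) ^ 2 * ((2 : ℝ) ^ 40 * klE3A1 R) := by gcongr

/-- Route (a), absolute value form: `klE3A1 R · |U| ≤ 2^-80`. -/
theorem klE3A1_mul_abs_le_of_le_klEngU₀9 (P : SplitConsts) {R : RenConsts} {c U : ℝ} (hU : 0 < U) (hUle : U ≤ klEngU₀9 P R c) :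
    klE3A1 R * |U| ≤ 1 / (2 : ℝ) ^ 80 := by
  rw [abs_of_pos hU]; exact klE3A1_mul_le_of_le_klEngU₀9 P hUle

/-- **Route (b)**: `U ≤ klEngU₀9 P R c ⟹ U ≤ 2^-128` (through `klEngU₀4 = 2^-128/(Psq⁴·Rsq⁴·(c²+1))`). -/
theorem le_two_pow_neg_of_le_klEngU₀9 (P : SplitConsts) {R : RenConsts} {c U : ℝ} (hUle : U ≤ klEngU₀9 P R c) :
    U ≤ 1 / (2 : ℝ) ^ 128 := by
  refine (hUle.trans (klEngU₀9_le_klEngU₀4 P R c)).trans ?_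
  rw [klEngU₀4]
  have hP : (1 : ℝ) ≤ klEngPsq P ^ 4 := one_le_pow₀ (one_le_klEngPsq P)
  have hR : (1 : ℝ) ≤ klEngRsq R ^ 4 := one_le_pow₀ (one_le_klEngRsq R)
  have hc2 : (1 : ℝ) ≤ c ^ 2 + 1 := by nlinarith [sq_nonneg c]
  refine one_div_le_one_div_of_le (by positivity) ?_
  calc (2 : ℝ) ^ 128 = (2 : ℝ) ^ 128 * 1 * 1 * 1 := by ring
    _ ≤ (2 : ℝ) ^ 128 * klEngPsq P ^ 4 * klEngRsq R ^ 4 * (c ^ 2 + 1) := by gcongr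

/-- Route (b), absolute value form: `|U| ≤ 2^-128`. -/
theorem abs_le_two_pow_neg_of_le_klEngU₀9 (P : SplitConsts) {R : RenConsts} {c U : ℝ} (hU : 0 < U) (hUle : U ≤ klEngU₀9 P R c) :
    |U| ≤ 1 / (2 : ℝ) ^ 128 := by
  rw [abs_of_pos hU]; exact le_two_pow_neg_of_le_klEngU₀9 P hUle

/-- `U ≤ klEngU₀9 P R c ⟹ |U| ≤ 1` (`0 < U`). -/
theorem abs_le_one_of_le_klEngU₀9 (P : SplitConsts) {R : RenConsts} {c U : ℝ} (hU : 0 < U) (hUle : U ≤ klEngU₀9 P R c) : |U| ≤ 1 := by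
  rw [abs_of_pos hU]; exact le_one_of_le_klEngU₀3 (hUle.trans (klEngU₀9_le_klEngU₀3 P R c))

/-! ## §3 One-volume data with the constant `a := klE3A1 R` -/

section OneVolume

variable {L M : ℕ} [NeZero L] [NeZero M] {R : RenConsts} {U μ β : ℝ}

/-- **`gridLabelWt`-weighted ROW sums `≤ (N/β)·klE3A1 R`** of `G_L = S_Lᵀ C⁰_{>e₀} S_L` at the registered thresholds (p3's X5 bound at frame
depth `0`, majorised by `bareAlphaOne_le_klE3A1`). -/
theorem rowWt_scaleZero_le_klE3A1 (hK : FrameOK R U 0 μ 0) (hR : R.WF) (hU1 : |U| ≤ 1) (hβ : klBetaMin ≤ β)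
    (hL : klEngL₃ β U ≤ L) (hM : klEngM₃ β U L ≤ M) (X : GridLeg (GridPoint L (2 * (2 * M)))) :
    ∑ Y : GridLeg (GridPoint L (2 * (2 * M))),
        ‖((hubbardGridSub L M β (2 * (2 * M))).transpose * hubbardCovAboveCT L M β μ 0 0 klE0 * hubbardGridSub L M β (2 * (2 * M))) X Y‖ *
          gridLabelWt L (2 * (2 * M)) β {gridLegPos X, gridLegPos Y} ≤ ((2 * (2 * M) : ℕ) : ℝ) / β * klE3A1 R := by
  have hβ0 : 0 < β := lt_of_lt_of_le (by norm_num [klBetaMin]) hβ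
  refine (rowSum_scaleZero_gridLabelWt_le_X5 hK hR hU1 hβ hL hM X).trans ?_
  exact mul_le_mul_of_nonneg_left (bareAlphaOne_le_klE3A1 R hU1) (div_nonneg (Nat.cast_nonneg _) hβ0.le)

/-- **`gridLabelWt`-weighted COLUMN sums `≤ (N/β)·klE3A1 R`.** -/
theorem colWt_scaleZero_le_klE3A1 (hK : FrameOK R U 0 μ 0) (hR : R.WF) (hU1 : |U| ≤ 1) (hβ : klBetaMin ≤ β)
    (hL : klEngL₃ β U ≤ L) (hM : klEngM₃ β U L ≤ M) (Y : GridLeg (GridPoint L (2 * (2 * M)))) :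
    ∑ X : GridLeg (GridPoint L (2 * (2 * M))),
        ‖((hubbardGridSub L M β (2 * (2 * M))).transpose * hubbardCovAboveCT L M β μ 0 0 klE0 * hubbardGridSub L M β (2 * (2 * M))) X Y‖ *
          gridLabelWt L (2 * (2 * M)) β {gridLegPos X, gridLegPos Y} ≤ ((2 * (2 * M) : ℕ) : ℝ) / β * klE3A1 R := by
  have hβ0 : 0 < β := lt_of_lt_of_le (by norm_num [klBetaMin]) hβ
  refine (colSum_scaleZero_gridLabelWt_le_X5 hK hR hU1 hβ hL hM Y).trans ?_
  exact mul_le_mul_of_nonneg_left (bareAlphaOne_le_klE3A1 R hU1) (div_nonneg (Nat.cast_nonneg _) hβ0.le)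

omit [NeZero M] in
/-- The `(1 + tnorm)` pair weight is dominated by `gridLabelWt {pos X, pos Y}` (`0 ≤ β`). -/
theorem one_add_tnorm_le_gridLabelWt_pair (hβ0 : 0 ≤ β) (X Y : GridLeg (GridPoint L (2 * (2 * M)))) :
    1 + (Torus.tnorm (X.1.1.2 - Y.1.1.2) : ℝ) ≤ gridLabelWt L (2 * (2 * M)) β {gridLegPos X, gridLegPos Y} := by
  classical
  have h := one_add_labelDiam_tnorm_le_gridLabelWt (L := L) (Ng := 2 * (2 * M)) hβ0 ({X, Y} : Finset _)
  rw [labelDiam_pair isLabelDist_tnorm_site, Finset.image_insert, Finset.image_singleton] at h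
  exact h

/-- **`(1 + tnorm)`-weighted row sums `≤ (N/β)·klE3A1 R`** (the `…TwoVolumeDataKit` currency). -/
theorem rowOneAddTnorm_scaleZero_le_klE3A1 (hK : FrameOK R U 0 μ 0) (hR : R.WF) (hU1 : |U| ≤ 1) (hβ : klBetaMin ≤ β)
    (hL : klEngL₃ β U ≤ L) (hM : klEngM₃ β U L ≤ M) (X : GridLeg (GridPoint L (2 * (2 * M)))) :
    ∑ Y : GridLeg (GridPoint L (2 * (2 * M))),
        ‖((hubbardGridSub L M β (2 * (2 * M))).transpose * hubbardCovAboveCT L M β μ 0 0 klE0 * hubbardGridSub L M β (2 * (2 * M))) X Y‖ *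
          (1 + (Torus.tnorm (X.1.1.2 - Y.1.1.2) : ℝ)) ≤ ((2 * (2 * M) : ℕ) : ℝ) / β * klE3A1 R := by
  have hβ0 : 0 < β := lt_of_lt_of_le (by norm_num [klBetaMin]) hβ
  exact (sum_le_sum fun Y _ => mul_le_mul_of_nonneg_left (one_add_tnorm_le_gridLabelWt_pair hβ0.le X Y) (norm_nonneg _)).trans
    (rowWt_scaleZero_le_klE3A1 hK hR hU1 hβ hL hM X)

/-- **Plain row sums `≤ (N/β)·klE3A1 R`.** -/
theorem row_scaleZero_le_klE3A1 (hK : FrameOK R U 0 μ 0) (hR : R.WF) (hU1 : |U| ≤ 1) (hβ : klBetaMin ≤ β)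
    (hL : klEngL₃ β U ≤ L) (hM : klEngM₃ β U L ≤ M) (X : GridLeg (GridPoint L (2 * (2 * M)))) :
    ∑ Y : GridLeg (GridPoint L (2 * (2 * M))),
        ‖((hubbardGridSub L M β (2 * (2 * M))).transpose * hubbardCovAboveCT L M β μ 0 0 klE0 * hubbardGridSub L M β (2 * (2 * M))) X Y‖ ≤
      ((2 * (2 * M) : ℕ) : ℝ) / β * klE3A1 R := by
  refine le_trans (sum_le_sum fun Y _ => ?_) (rowOneAddTnorm_scaleZero_le_klE3A1 hK hR hU1 hβ hL hM X)
  have h0 := norm_nonneg (((hubbardGridSub L M β (2 * (2 * M))).transpose * hubbardCovAboveCT L M β μ 0 0 klE0 *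
    hubbardGridSub L M β (2 * (2 * M))) X Y)
  have h1 : (0 : ℝ) ≤ (Torus.tnorm (X.1.1.2 - Y.1.1.2) : ℝ) := Nat.cast_nonneg _
  nlinarith

/-- **`tnorm`-weighted row sums (first moments) `≤ (N/β)·klE3A1 R`.** -/
theorem rowTnorm_scaleZero_le_klE3A1 (hK : FrameOK R U 0 μ 0) (hR : R.WF) (hU1 : |U| ≤ 1) (hβ : klBetaMin ≤ β)
    (hL : klEngL₃ β U ≤ L) (hM : klEngM₃ β U L ≤ M) (X : GridLeg (GridPoint L (2 * (2 * M)))) :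
    ∑ Y : GridLeg (GridPoint L (2 * (2 * M))),
        ‖((hubbardGridSub L M β (2 * (2 * M))).transpose * hubbardCovAboveCT L M β μ 0 0 klE0 * hubbardGridSub L M β (2 * (2 * M))) X Y‖ *
          (Torus.tnorm (X.1.1.2 - Y.1.1.2) : ℝ) ≤ ((2 * (2 * M) : ℕ) : ℝ) / β * klE3A1 R := by
  refine le_trans (sum_le_sum fun Y _ => ?_) (rowOneAddTnorm_scaleZero_le_klE3A1 hK hR hU1 hβ hL hM X)
  have h0 := norm_nonneg (((hubbardGridSub L M β (2 * (2 * M))).transpose * hubbardCovAboveCT L M β μ 0 0 klE0 *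
    hubbardGridSub L M β (2 * (2 * M))) X Y)
  nlinarith

/-- **Reduced-`tnorm`-weighted row sums `≤ (N/β)·klE3A1 R`** (coarse distance of the reductions mod `Lc ∣ L`, …DataKit). -/
theorem rowTnormReduce_scaleZero_le_klE3A1 {Lc : ℕ} [NeZero Lc] (hLc : Lc ∣ L) (hK : FrameOK R U 0 μ 0) (hR : R.WF)
    (hU1 : |U| ≤ 1) (hβ : klBetaMin ≤ β) (hL : klEngL₃ β U ≤ L) (hM : klEngM₃ β U L ≤ M) (X : GridLeg (GridPoint L (2 * (2 * M)))) :
    ∑ Y : GridLeg (GridPoint L (2 * (2 * M))),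
        ‖((hubbardGridSub L M β (2 * (2 * M))).transpose * hubbardCovAboveCT L M β μ 0 0 klE0 * hubbardGridSub L M β (2 * (2 * M))) X Y‖ *
          (Torus.tnorm ((fun i => (((X.1.1.2 i).val : ℕ) : ZMod Lc)) - fun i => (((Y.1.1.2 i).val : ℕ) : ZMod Lc)) : ℝ) ≤
      ((2 * (2 * M) : ℕ) : ℝ) / β * klE3A1 R :=
  (sum_norm_mul_tnorm_reduce_le hLc _ X).trans (rowTnorm_scaleZero_le_klE3A1 hK hR hU1 hβ hL hM X)

/-- **All-times far row tails `≤ ((N/β)·klE3A1 R)/(R′+1)`** (…DataKit's `sum_far_norm_le_of_weightedRow`). -/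
theorem farRow_scaleZero_le_klE3A1 (hK : FrameOK R U 0 μ 0) (hR : R.WF) (hU1 : |U| ≤ 1) (hβ : klBetaMin ≤ β)
    (hL : klEngL₃ β U ≤ L) (hM : klEngM₃ β U L ≤ M) (R' : ℕ) (X : GridLeg (GridPoint L (2 * (2 * M)))) :
    ∑ Y ∈ univ.filter (fun Y : GridLeg (GridPoint L (2 * (2 * M))) => R' < Torus.tnorm (X.1.1.2 - Y.1.1.2)),
        ‖((hubbardGridSub L M β (2 * (2 * M))).transpose * hubbardCovAboveCT L M β μ 0 0 klE0 * hubbardGridSub L M β (2 * (2 * M))) X Y‖ ≤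
      ((2 * (2 * M) : ℕ) : ℝ) / β * klE3A1 R / ((R' : ℝ) + 1) :=
  sum_far_norm_le_of_weightedRow _ R' X (rowOneAddTnorm_scaleZero_le_klE3A1 hK hR hU1 hβ hL hM X)

/-! ## §4 FILE D at `ρ₀ = 2^15` with its smallness discharged -/

/-- **The smallness of `scaleZero_gridData` at `ρ₀ = 2^15` under `klE3A1 R·|U| ≤ 2^-80`**: with `αw = (N/β)·klE3A1 R` and the bare vertex
profile, `θ₀ = e·αw·normV(κ₀, 2^15, Nv)/κ₀² ≤ 2^-16` (`0 < β`). -/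
theorem theta0_scaleZero_le (hβ0 : 0 < β) (hAU : klE3A1 R * |U| ≤ 1 / (2 : ℝ) ^ 80) :
    Real.exp 1 * (((2 * (2 * M) : ℕ) : ℝ) / β * klE3A1 R) *
        normV (GridLeg (GridPoint L (2 * (2 * M)))) (Real.sqrt (2 * (7 + 6047))) ((2 : ℝ) ^ 15)
          (fun m' : ℕ => if m' = 1 then |β| / (2 * (2 * M) : ℕ) * ∑ z : TorusSite 2 L, ‖framePosKernel L (0 : TrigPolyC4v) z‖ * (1 + torusSiteDist z 0)
            else if m' = 2 then |U| * |β| / (2 * (2 * M) : ℕ) else 0) / Real.sqrt (2 * (7 + 6047)) ^ 2 ≤ 1 / (2 : ℝ) ^ 16 := by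
  haveI : NeZero (2 * (2 * M)) := ⟨by have := NeZero.ne M; omega⟩
  rw [normV_bareGridVertex, sqrt_gramSharp_sq, abs_of_pos hβ0]
  have hN : (0 : ℝ) < ((2 * (2 * M) : ℕ) : ℝ) := by exact_mod_cast Nat.pos_of_ne_zero (NeZero.ne _)
  have hA := klE3A1_pos R
  have hW := vertexWeight_pow_four_le_two_pow
  have he : Real.exp 1 ≤ 3 := by have := Real.exp_one_lt_d9; linarith
  have hkey : Real.exp 1 * (((2 * (2 * M) : ℕ) : ℝ) / β * klE3A1 R) *
      ((Real.exp 2 * (Real.sqrt (2 * (7 + 6047)) + 2 ^ 15)) ^ 4 * (|U| * β / ((2 * (2 * M) : ℕ) : ℝ))) =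
      Real.exp 1 * (klE3A1 R * |U|) * (Real.exp 2 * (Real.sqrt (2 * (7 + 6047)) + 2 ^ 15)) ^ 4 := by
    field_simp
  rw [hkey, div_le_div_iff₀ (by norm_num) (by positivity)]
  have h1 : Real.exp 1 * (klE3A1 R * |U|) * (Real.exp 2 * (Real.sqrt (2 * (7 + 6047)) + 2 ^ 15)) ^ 4 ≤ 3 * (1 / (2 : ℝ) ^ 80) * (2 : ℝ) ^ 72 := by
    have h00 : 0 ≤ klE3A1 R * |U| := by positivity
    gcongr
  have h2 : Real.exp 1 * (klE3A1 R * |U|) * (Real.exp 2 * (Real.sqrt (2 * (7 + 6047)) + 2 ^ 15)) ^ 4 ≤ 3 / 256 := h1.trans (by norm_num)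
  have h3 := mul_le_mul_of_nonneg_right h2 (show (0 : ℝ) ≤ (2 : ℝ) ^ 16 by positivity)
  refine h3.trans ?_
  norm_num

/-- **ONE-VOLUME SCALE-`0` GRID DATA AT THE REGISTERED THRESHOLDS** (`ρ₀ = 2^15`): for an admissible bare frame at depth `0`, `R.WF`,
`klBetaMin ≤ β`, `klEngL₃ β U ≤ L`, `klEngM₃ β U L ≤ M` and the door consequence `klE3A1 R·|U| ≤ 2^-80` (`|U| ≤ 1`): the grid covariance
`G_L = S_Lᵀ C⁰_{>e₀} S_L` on `N = 2(2M)` is replica-Gram-bounded by `√(2(7+6047))`, the bare grid partition function is a unit, and the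
`(1+diam_{tnorm})`-weighted pinned profile of `effAction G_L V_N` is `≤ (2^15)⁻¹^(2m′)·(6·2^72·|U|·|β|/N)` in every even degree `2m′`. -/
theorem scaleZero_gridData_registered (hK : FrameOK R U 0 μ 0) (hR : R.WF) (hU1 : |U| ≤ 1) (hβ : klBetaMin ≤ β)
    (hL : klEngL₃ β U ≤ L) (hM : klEngM₃ β U L ≤ M) (hAU : klE3A1 R * |U| ≤ 1 / (2 : ℝ) ^ 80) :
    IsGramBoundedR ((hubbardGridSub L M β (2 * (2 * M))).transpose * hubbardCovAboveCT L M β μ 0 0 klE0 *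
        hubbardGridSub L M β (2 * (2 * M))) (Real.sqrt (2 * (7 + 6047))) ∧
      IsUnit (effPartitionFn ℂ ((hubbardGridSub L M β (2 * (2 * M))).transpose * hubbardCovAboveCT L M β μ 0 0 klE0 *
        hubbardGridSub L M β (2 * (2 * M))) (hubbardGridInteraction L (2 * (2 * M)) β U)) ∧
      ∀ (m' : ℕ) (j : Fin (2 * m')) (x : GridLeg (GridPoint L (2 * (2 * M)))),
        ∑ Y ∈ univ.filter (fun Y : Fin (2 * m') → GridLeg (GridPoint L (2 * (2 * M))) => Y j = x),
          ‖kernel ℂ (effAction ℂ ((hubbardGridSub L M β (2 * (2 * M))).transpose * hubbardCovAboveCT L M β μ 0 0 klE0 *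
              hubbardGridSub L M β (2 * (2 * M))) (hubbardGridInteraction L (2 * (2 * M)) β U)) (2 * m') Y‖ *
            (1 + labelDiam (fun Y₁ Y₂ : GridLeg (GridPoint L (2 * (2 * M))) => (Torus.tnorm (Y₁.1.1.2 - Y₂.1.1.2) : ℝ)) (univ.image Y)) ≤
          ((2 : ℝ) ^ 15)⁻¹ ^ (2 * m') * (6 * (2 : ℝ) ^ 72 * |U| * |β| / ((2 * (2 * M) : ℕ) : ℝ)) := by
  haveI : NeZero (2 * (2 * M)) := ⟨by have := NeZero.ne M; omega⟩
  have hβ0 : 0 < β := lt_of_lt_of_le (by norm_num [klBetaMin]) hβ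
  have hβL : β ≤ L := le_of_klEngL₃_le hL
  have hN : (0 : ℝ) < ((2 * (2 * M) : ℕ) : ℝ) := by exact_mod_cast Nat.pos_of_ne_zero (NeZero.ne _)
  have hA := klE3A1_pos R
  have hαw : 0 < ((2 * (2 * M) : ℕ) : ℝ) / β * klE3A1 R := by positivity
  have hθ := theta0_scaleZero_le (L := L) (M := M) (R := R) (U := U) hβ0 hAU
  have hθ1 : Real.exp 1 * (((2 * (2 * M) : ℕ) : ℝ) / β * klE3A1 R) *
        normV (GridLeg (GridPoint L (2 * (2 * M)))) (Real.sqrt (2 * (7 + 6047))) ((2 : ℝ) ^ 15)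
          (fun m' : ℕ => if m' = 1 then |β| / (2 * (2 * M) : ℕ) * ∑ z : TorusSite 2 L, ‖framePosKernel L (0 : TrigPolyC4v) z‖ * (1 + torusSiteDist z 0)
            else if m' = 2 then |U| * |β| / (2 * (2 * M) : ℕ) else 0) / Real.sqrt (2 * (7 + 6047)) ^ 2 < 1 :=
    lt_of_le_of_lt hθ (by norm_num)
  obtain ⟨hGB, hZ, hprof⟩ := scaleZero_gridData (L := L) (M := M) hK hβ hβL hαw (rowWt_scaleZero_le_klE3A1 hK hR hU1 hβ hL hM)
    (colWt_scaleZero_le_klE3A1 hK hR hU1 hβ hL hM) (show (0 : ℝ) < (2 : ℝ) ^ 15 by positivity) hθ1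
  refine ⟨hGB, hZ, fun m' j x => ?_⟩
  have hρpow : (0 : ℝ) ≤ ((2 : ℝ) ^ 15)⁻¹ ^ (2 * m') := by positivity
  have hpr := hprof m' j x
  rw [mul_div_assoc] at hpr
  refine hpr.trans (mul_le_mul_of_nonneg_left ?_ hρpow)
  -- `e·normV/(1 − θ₀) ≤ 6·2^72·|U|·|β|/N`
  have hθ' : 1 / 2 ≤ 1 - Real.exp 1 * (((2 * (2 * M) : ℕ) : ℝ) / β * klE3A1 R) *
        normV (GridLeg (GridPoint L (2 * (2 * M)))) (Real.sqrt (2 * (7 + 6047))) ((2 : ℝ) ^ 15)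
          (fun m' : ℕ => if m' = 1 then |β| / (2 * (2 * M) : ℕ) * ∑ z : TorusSite 2 L, ‖framePosKernel L (0 : TrigPolyC4v) z‖ * (1 + torusSiteDist z 0)
            else if m' = 2 then |U| * |β| / (2 * (2 * M) : ℕ) else 0) / Real.sqrt (2 * (7 + 6047)) ^ 2 := by
    have : (1 : ℝ) / (2 : ℝ) ^ 16 ≤ 1 / 2 := by norm_num
    linarith
  rw [div_le_iff₀ (by linarith), normV_bareGridVertex]
  rw [normV_bareGridVertex] at hθ'
  have he : Real.exp 1 ≤ 3 := by have := Real.exp_one_lt_d9; linarith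
  have hW := vertexWeight_pow_four_le_two_pow
  have hUβ : 0 ≤ |U| * |β| / ((2 * (2 * M) : ℕ) : ℝ) := by positivity
  calc Real.exp 1 * ((Real.exp 2 * (Real.sqrt (2 * (7 + 6047)) + 2 ^ 15)) ^ 4 * (|U| * |β| / ((2 * (2 * M) : ℕ) : ℝ)))
      ≤ 3 * ((2 : ℝ) ^ 72 * (|U| * |β| / ((2 * (2 * M) : ℕ) : ℝ))) := by gcongr
    _ = 6 * (2 : ℝ) ^ 72 * |U| * |β| / ((2 * (2 * M) : ℕ) : ℝ) * (1 / 2) := by ring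
    _ ≤ 6 * (2 : ℝ) ^ 72 * |U| * |β| / ((2 * (2 * M) : ℕ) : ℝ) * _ := by gcongr

end OneVolume

end Summit.HubbardSuperconductivity.HubbardSuperconductivity.Theorems.TwoVolumeDefect

end
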